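import Mathlib.Analysis.Normed.Group.FunctionSeries
import Mathlib.Analysis.Normed.Group.InfiniteSum
import Mathlib.Topology.Algebra.InfiniteSum.ENNReal
import Mathlib.Analysis.SpecialFunctions.Pow.NNReal
import Mathlib.Topology.UniformSpace.HeineCantor
import Mathlib.Analysis.SpecialFunctions.Pow.Continuity
import Literature.Analysis.FunctionSpaces.HolderInterpolation
import Literature.Analysis.FunctionSpaces.HolderNorm
import Literature.Analysis.FunctionSpaces.TorusHolderBridge
import HarnessLib

/-!
# Series in Hölder spaces: the Weierstrass M-test in `C^{0,r}` and in `C⁰_t C^{0,r}_x`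

Analysis/FunctionSpaces support file (everything proved; no definitions, no named facts). For the
tree's Hölder vocabulary (`eSupNorm`, Mathlib's `eHolderNorm`, `eBoundedHolderNorm = ‖·‖_∞ + [·]_r`,
`MemBoundedHolder`, `ContinuousInHolderOn S r u` = `u ∈ C⁰(S; C^{0,r})`, file `HolderNorm.lean`) we
record the elementary facts about SERIES `x ↦ ∑' i, f i x` that the tree lacked:

* `holderWith_tsum` — a pointwise-summable series of `r`-Hölder maps with summable constants `C i`
  is `r`-Hölder with constant `∑' i, C i`;
* `eSupNorm_tsum_le`, `eHolderNorm_tsum_le`, `eBoundedHolderNorm_tsum_le` — the norms of the series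
  are at most the series of the norms (`‖∑ fᵢ‖_{C^{0,r}} ≤ ∑ ‖fᵢ‖_{C^{0,r}}`, Gilbarg–Trudinger §4.1:
  `C^{k,α}` is a Banach space); `summable_apply_of_tsum_eSupNorm_ne_top`, `memBoundedHolder_tsum`
  (normal convergence ⇒ pointwise absolute convergence and membership of the sum),
  `tendstoUniformly_sum_of_tsum_eSupNorm_ne_top` (uniform convergence of the partial sums);
* `ContinuousInHolderOn.tsum` — **the M-test in `C⁰_t C^{0,r}_x`**: if every level
  `f i : ℝ → X → Y` is continuous on `S` with values in `C^{0,r}` and `sup_{t ∈ S} ‖f i t‖_{C^{0,r}} ≤ M i`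
  with `∑' i, M i < ∞`, then the series `t ↦ (x ↦ ∑' i, f i t x)` is continuous on `S` with values
  in `C^{0,r}`, with norms `≤ ∑' i, M i`;
* `ContinuousInHolderOn.mono/.union/.Icc_union_Icc`, `continuousInHolderOn_univ_of_windows` — time
  sets: restriction, union of two CLOSED time sets, gluing of adjacent intervals, locally finite
  window covers `[jτ, (j+1)τ]`, `j ∈ ℤ` ⇒ all of `ℝ`;
* `continuousInHolderOn_univ_of_continuous_of_lipschitzWith` — the CONSTRUCTOR from joint continuity
  on `ℝ × X` (`X` compact) and an `x`-Lipschitz bound uniform in `t`, for exponents `r < 1` (tube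
  lemma + interpolation: `‖v t − v t₀‖_{C^{0,r}} ≤ osc + 2(2K)^r (2 osc)^{1-r} → 0`); torus corollary
  `Torus.continuousInHolderOn_univ_of_continuous_of_norm_partialDeriv_le`;
* `holderWith_of_lipschitzWith_of_edist_le_opt` — the OPTIMISED interpolation inequality
  `[f]_r ≤ 2 L^r B^{1-r}` for an `L`-Lipschitz map of oscillation `≤ B` (the tree's scale-`δ`
  inequality `HolderInterpolation.holderWith_of_lipschitzWith_of_edist_le` at `δ = B/L`;
  Gilbarg–Trudinger (6.8)–(6.9)), with its `eBoundedHolderNorm` form.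

Written for the regularity clause `C⁰_t C^{0,α}_x` of multiscale carriers that are infinite sums of
smooth levels with geometrically decaying amplitudes (Armstrong–Vicol 2025, §2.2: `b = lim b_m`,
`‖b_m‖_∞ ≲ a_m/N_m`, `‖∇b_m‖_∞ ≲ a_m`, so `‖b_m‖_{C^α} ≲ a_m N_m^{α-1}`), but stated in Mathlib
generality: `X` a (pseudo-e)metric space, `Y` a complete normed group, any index type. (A
route-side, `ℕ`-indexed twin of the three `…_tsum_le` bounds and of the M-test with real majorants
exists under `Summits/AnomalousDissipation/…/SolenoidalFractalHomogenisationPermissibleFractalCarrierSeries.lean`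
(namespace `…PermissibleCarrier`, Tannery's theorem); this file is the summit-independent Literature
home, and adds the optimised interpolation, membership and uniform-convergence statements.)

## References

* D. Gilbarg, N. S. Trudinger, *Elliptic Partial Differential Equations of Second Order*,
  Springer 2001, §4.1 (Hölder spaces are Banach spaces), (6.8)–(6.9) (interpolation). [GilbargTrudinger2001]
* S. Armstrong, V. Vicol, *Anomalous diffusion by fractal homogenization*, Ann. PDE 11 (2025),
  §2.2 (the carrier as the limit of the partial sums). [ArmstrongVicol2025]
-/

noncomputable section

open Set Filter Topology Function
open scoped NNReal ENNReal Topology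

namespace Literature.Analysis.FunctionSpaces

variable {ι : Type*} {X : Type*} {Y : Type*}

/-! ## Optimised interpolation between a Lipschitz bound and an oscillation bound -/

section Interpolation

variable [PseudoEMetricSpace X] [PseudoEMetricSpace Y]

/-- **Interpolation, optimised in the scale.** An `L`-Lipschitz map with oscillation `≤ B`
(`edist (f x) (f y) ≤ B`) is `r`-Hölder, `r ≤ 1`, with constant `2 L^r B^{1-r}` (the scale-`δ`
inequality `L δ^{1-r} + B δ^{-r}` of `holderWith_of_lipschitzWith_of_edist_le` at `δ = B/L`; the
degenerate cases `L = 0` or `B = 0` — a map of zero oscillation — hold trivially).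
[cite: GilbargTrudinger2001, (6.8)–(6.9)] -/
theorem holderWith_of_lipschitzWith_of_edist_le_opt {f : X → Y} {L B : ℝ≥0} (hL : LipschitzWith L f)
    (hB : ∀ x y, edist (f x) (f y) ≤ B) {r : ℝ≥0} (hr : r ≤ 1) :
    HolderWith (2 * L ^ (r : ℝ) * B ^ (1 - r : ℝ)) r f := by
  have hr0 : (0 : ℝ) ≤ r := r.2
  have hr1 : (r : ℝ) ≤ 1 := by exact_mod_cast hr
  -- degenerate cases: zero oscillation
  by_cases hB0 : B = 0
  · subst hB0
    have hzero : ∀ x y, edist (f x) (f y) = 0 := fun x y => le_antisymm (by simpa using hB x y) bot_le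
    intro x y
    rw [hzero]
    exact bot_le
  by_cases hL0 : L = 0
  · subst hL0
    have hzero : ∀ x y, edist (f x) (f y) = 0 := fun x y =>
      le_antisymm (by simpa using hL x y) bot_le
    intro x y
    rw [hzero]
    exact bot_le
  have hBpos : 0 < B := pos_iff_ne_zero.2 hB0
  have hLpos : 0 < L := pos_iff_ne_zero.2 hL0
  -- the scale `δ = B / L`
  have hδ : 0 < B / L := div_pos hBpos hLpos
  have h := holderWith_of_lipschitzWith_of_edist_le hL hB hr hδ
  have hconst : L * (B / L) ^ (1 - r : ℝ) + B * (B / L)⁻¹ ^ (r : ℝ) = 2 * L ^ (r : ℝ) * B ^ (1 - r : ℝ) := by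
    have hL' : (L : ℝ) ≠ 0 := by exact_mod_cast hL0
    have hB' : (B : ℝ) ≠ 0 := by exact_mod_cast hB0
    have hLp : 0 < (L : ℝ) := by exact_mod_cast hLpos
    have hBp : 0 < (B : ℝ) := by exact_mod_cast hBpos
    apply NNReal.coe_injective
    simp only [NNReal.coe_add, NNReal.coe_mul, NNReal.coe_rpow, NNReal.coe_div, NNReal.coe_inv,
      NNReal.coe_ofNat]
    rw [inv_div, Real.div_rpow hBp.le hLp.le, Real.div_rpow hLp.le hBp.le]
    have k1 : (L : ℝ) / (L : ℝ) ^ (1 - r : ℝ) = (L : ℝ) ^ (r : ℝ) := by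
      have h1 := Real.rpow_sub hLp 1 (1 - r)
      rw [Real.rpow_one, sub_sub_cancel] at h1
      exact h1.symm
    have k2 : (B : ℝ) / (B : ℝ) ^ (r : ℝ) = (B : ℝ) ^ (1 - r : ℝ) := by
      have h2 := Real.rpow_sub hBp 1 r
      rw [Real.rpow_one] at h2
      exact h2.symm
    calc (L : ℝ) * ((B : ℝ) ^ (1 - r : ℝ) / (L : ℝ) ^ (1 - r : ℝ)) + (B : ℝ) * ((L : ℝ) ^ (r : ℝ) / (B : ℝ) ^ (r : ℝ))
        = (L : ℝ) / (L : ℝ) ^ (1 - r : ℝ) * (B : ℝ) ^ (1 - r : ℝ) + (B : ℝ) / (B : ℝ) ^ (r : ℝ) * (L : ℝ) ^ (r : ℝ) := by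
          ring
      _ = (L : ℝ) ^ (r : ℝ) * (B : ℝ) ^ (1 - r : ℝ) + (B : ℝ) ^ (1 - r : ℝ) * (L : ℝ) ^ (r : ℝ) := by rw [k1, k2]
      _ = 2 * (L : ℝ) ^ (r : ℝ) * (B : ℝ) ^ (1 - r : ℝ) := by ring
  rw [← hconst]
  exact h

end Interpolation

section InterpolationNormed

variable [PseudoEMetricSpace X] [NormedAddCommGroup Y]

/-- **`C^{0,r}` norm from a sup bound and a Lipschitz bound, optimised.** If `‖f x‖ ≤ M` for all
`x` and `f` is `L`-Lipschitz then, for `r ≤ 1`, `‖f‖_∞ + [f]_r ≤ M + 2 L^r (2M)^{1-r}`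
(oscillation `≤ 2M`). [cite: GilbargTrudinger2001, (6.8)–(6.9) and §4.1] -/
theorem eBoundedHolderNorm_le_of_norm_le_of_lipschitzWith {f : X → Y} {L M : ℝ≥0}
    (hM : ∀ x, ‖f x‖ ≤ M) (hL : LipschitzWith L f) {r : ℝ≥0} (hr : r ≤ 1) :
    eBoundedHolderNorm r f ≤ ((M + 2 * L ^ (r : ℝ) * (2 * M) ^ (1 - r : ℝ) : ℝ≥0) : ℝ≥0∞) := by
  have hM' : ∀ x, ‖f x‖ₑ ≤ M := fun x => by
    rw [← ofReal_norm, ← ENNReal.ofReal_coe_nnreal]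
    exact ENNReal.ofReal_le_ofReal (hM x)
  have hB : ∀ x y, edist (f x) (f y) ≤ ((2 * M : ℝ≥0) : ℝ≥0∞) := fun x y => by
    rw [edist_eq_enorm_sub]
    calc ‖f x - f y‖ₑ ≤ ‖f x‖ₑ + ‖f y‖ₑ := enorm_sub_le
      _ ≤ M + M := add_le_add (hM' x) (hM' y)
      _ = ((2 * M : ℝ≥0) : ℝ≥0∞) := by push_cast; ring
  have hH := holderWith_of_lipschitzWith_of_edist_le_opt hL hB hr
  rw [eBoundedHolderNorm_def, ENNReal.coe_add]
  exact add_le_add (iSup_le hM') hH.eHolderNorm_le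

end InterpolationNormed

/-! ## Series of Hölder maps -/

section HolderSeries

variable [PseudoEMetricSpace X] [NormedAddCommGroup Y]

/-- **A series of `r`-Hölder maps with summable constants is `r`-Hölder** with constant the sum of
the constants, provided it converges pointwise:
`‖∑ fᵢ(x) − ∑ fᵢ(y)‖ ≤ ∑ ‖fᵢ(x) − fᵢ(y)‖ ≤ (∑ Cᵢ) d(x,y)^r`. [cite: GilbargTrudinger2001, §4.1] -/
theorem holderWith_tsum {f : ι → X → Y} {C : ι → ℝ≥0} {r : ℝ≥0} (hf : ∀ i, HolderWith (C i) r (f i))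
    (hC : Summable C) (hs : ∀ x, Summable fun i => f i x) :
    HolderWith (∑' i, C i) r (fun x => ∑' i, f i x) := by
  intro x y
  rw [edist_eq_enorm_sub, ← (hs x).tsum_sub (hs y), ENNReal.coe_tsum hC, ← ENNReal.tsum_mul_right]
  refine enorm_tsum_le_tsum_enorm.trans (ENNReal.tsum_le_tsum fun i => ?_)
  rw [← edist_eq_enorm_sub]
  exact hf i x y

end HolderSeries

section SupSeries

variable [NormedAddCommGroup Y]

/-- **The sup norm of a series is at most the series of the sup norms** (no convergence hypothesis:
a non-summable value of the series is `0` by convention). [cite: GilbargTrudinger2001, §4.1] -/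
theorem eSupNorm_tsum_le (f : ι → X → Y) : eSupNorm (fun x => ∑' i, f i x) ≤ ∑' i, eSupNorm (f i) := by
  refine iSup_le fun x => ?_
  exact enorm_tsum_le_tsum_enorm.trans (ENNReal.tsum_le_tsum fun i => enorm_le_eSupNorm (f i) x)

/-- **Normal convergence ⇒ pointwise absolute convergence**: if `∑ ‖fᵢ‖_∞ < ∞` then the series
converges (absolutely) at every point of a complete target. [cite: GilbargTrudinger2001, §4.1] -/
theorem summable_apply_of_tsum_eSupNorm_ne_top [CompleteSpace Y] {f : ι → X → Y}
    (h : ∑' i, eSupNorm (f i) ≠ ∞) (x : X) : Summable fun i => f i x := by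
  have hfin : ∀ i, eSupNorm (f i) ≠ ∞ := ENNReal.ne_top_of_tsum_ne_top h
  refine Summable.of_norm_bounded (g := fun i => (eSupNorm (f i)).toReal) (ENNReal.summable_toReal h) fun i => ?_
  have hx := enorm_le_eSupNorm (f i) x
  rw [← ofReal_norm] at hx
  exact (ENNReal.ofReal_le_iff_le_toReal (hfin i)).1 hx

/-- **Uniform convergence of the partial sums** of a normally convergent series (Weierstrass
M-test, `M i = ‖fᵢ‖_∞`). [cite: GilbargTrudinger2001, §4.1] -/
theorem tendstoUniformly_sum_of_tsum_eSupNorm_ne_top [CompleteSpace Y] {f : ι → X → Y}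
    (h : ∑' i, eSupNorm (f i) ≠ ∞) :
    TendstoUniformly (fun s : Finset ι => fun x => ∑ i ∈ s, f i x) (fun x => ∑' i, f i x) atTop := by
  have hfin : ∀ i, eSupNorm (f i) ≠ ∞ := ENNReal.ne_top_of_tsum_ne_top h
  refine tendstoUniformly_tsum (u := fun i => (eSupNorm (f i)).toReal) (ENNReal.summable_toReal h) fun i x => ?_
  have hx := enorm_le_eSupNorm (f i) x
  rw [← ofReal_norm] at hx
  exact (ENNReal.ofReal_le_iff_le_toReal (hfin i)).1 hx

/-- ℕ-indexed form: the partial sums `∑_{i<n} fᵢ` converge uniformly to the series when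
`∑ ‖fᵢ‖_∞ < ∞`. [cite: GilbargTrudinger2001, §4.1] -/
theorem tendstoUniformly_sum_range_of_tsum_eSupNorm_ne_top [CompleteSpace Y] {f : ℕ → X → Y}
    (h : ∑' i, eSupNorm (f i) ≠ ∞) :
    TendstoUniformly (fun n : ℕ => fun x => ∑ i ∈ Finset.range n, f i x) (fun x => ∑' i, f i x) atTop := by
  have hfin : ∀ i, eSupNorm (f i) ≠ ∞ := ENNReal.ne_top_of_tsum_ne_top h
  refine tendstoUniformly_tsum_nat (u := fun i => (eSupNorm (f i)).toReal) (ENNReal.summable_toReal h) fun i x => ?_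
  have hx := enorm_le_eSupNorm (f i) x
  rw [← ofReal_norm] at hx
  exact (ENNReal.ofReal_le_iff_le_toReal (hfin i)).1 hx

/-- **Uniform convergence of the partial sums in space–time** under the M-test hypotheses (sup part
only: `‖f i t x‖ ≤ ‖f i t‖_∞ ≤ M i`): `∑_{i<n} f i → ∑ f i` uniformly on `S × X`.
[cite: GilbargTrudinger2001, §4.1] -/
theorem tendstoUniformlyOn_sum_range_of_forall_eSupNorm_le [CompleteSpace Y] {S : Set ℝ} {f : ℕ → ℝ → X → Y}
    {M : ℕ → ℝ≥0∞} (hM : ∀ i, ∀ t ∈ S, eSupNorm (f i t) ≤ M i) (hMs : ∑' i, M i ≠ ∞) :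
    TendstoUniformlyOn (fun n : ℕ => fun p : ℝ × X => ∑ i ∈ Finset.range n, f i p.1 p.2)
      (fun p => ∑' i, f i p.1 p.2) atTop (S ×ˢ univ) := by
  have hfin : ∀ i, M i ≠ ∞ := ENNReal.ne_top_of_tsum_ne_top hMs
  refine tendstoUniformlyOn_tsum_nat (u := fun i => (M i).toReal) (ENNReal.summable_toReal hMs) fun i p hp => ?_
  have hx := (enorm_le_eSupNorm (f i p.1) p.2).trans (hM i p.1 (mem_prod.1 hp).1)
  rw [← ofReal_norm] at hx
  exact (ENNReal.ofReal_le_iff_le_toReal (hfin i)).1 hx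

end SupSeries

section SeriesMetric

variable [MetricSpace X] [NormedAddCommGroup Y]

/-- **The Hölder seminorm of a series is at most the series of the seminorms**, provided the series
converges pointwise. [cite: GilbargTrudinger2001, §4.1] -/
theorem eHolderNorm_tsum_le {f : ι → X → Y} {r : ℝ≥0} (hs : ∀ x, Summable fun i => f i x) :
    eHolderNorm r (fun x => ∑' i, f i x) ≤ ∑' i, eHolderNorm r (f i) := by
  by_cases htop : ∑' i, eHolderNorm r (f i) = ∞
  · rw [htop]; exact le_top
  have hfin : ∀ i, eHolderNorm r (f i) ≠ ∞ := ENNReal.ne_top_of_tsum_ne_top htop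
  have hmem : ∀ i, MemHolder r (f i) := fun i => eHolderNorm_ne_top.1 (hfin i)
  -- the constants `C i = nnHolderNorm r (f i)` are attained and summable
  have hC : Summable fun i => nnHolderNorm r (f i) := by
    rw [← ENNReal.tsum_coe_ne_top_iff_summable]
    simp_rw [fun i => (hmem i).coe_nnHolderNorm_eq_eHolderNorm]
    exact htop
  have h := holderWith_tsum (fun i => (hmem i).holderWith) hC hs
  refine h.eHolderNorm_le.trans (le_of_eq ?_)
  rw [ENNReal.coe_tsum hC]
  exact tsum_congr fun i => (hmem i).coe_nnHolderNorm_eq_eHolderNorm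

/-- **`‖∑ fᵢ‖_{C^{0,r}} ≤ ∑ ‖fᵢ‖_{C^{0,r}}`** for a pointwise convergent series (Gilbarg–Trudinger
§4.1: the `C^{k,α}` norms make Banach spaces). [cite: GilbargTrudinger2001, §4.1] -/
theorem eBoundedHolderNorm_tsum_le {f : ι → X → Y} {r : ℝ≥0} (hs : ∀ x, Summable fun i => f i x) :
    eBoundedHolderNorm r (fun x => ∑' i, f i x) ≤ ∑' i, eBoundedHolderNorm r (f i) := by
  rw [eBoundedHolderNorm_def]
  simp_rw [eBoundedHolderNorm_def]
  rw [ENNReal.tsum_add]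
  exact add_le_add (eSupNorm_tsum_le f) (eHolderNorm_tsum_le hs)

/-- Same bound without the convergence hypothesis when the target is complete: `∑ ‖fᵢ‖_{C^{0,r}} < ∞`
forces pointwise convergence. [cite: GilbargTrudinger2001, §4.1] -/
theorem eBoundedHolderNorm_tsum_le' [CompleteSpace Y] {f : ι → X → Y} {r : ℝ≥0}
    (h : ∑' i, eBoundedHolderNorm r (f i) ≠ ∞) :
    eBoundedHolderNorm r (fun x => ∑' i, f i x) ≤ ∑' i, eBoundedHolderNorm r (f i) := by
  have hsup : ∑' i, eSupNorm (f i) ≠ ∞ :=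
    ne_top_of_le_ne_top h (ENNReal.tsum_le_tsum fun i => eSupNorm_le_eBoundedHolderNorm r (f i))
  exact eBoundedHolderNorm_tsum_le (summable_apply_of_tsum_eSupNorm_ne_top hsup)

/-- **Normal convergence in `C^{0,r}` ⇒ the sum is in `C^{0,r}`** (complete target).
[cite: GilbargTrudinger2001, §4.1] -/
theorem memBoundedHolder_tsum [CompleteSpace Y] {f : ι → X → Y} {r : ℝ≥0}
    (h : ∑' i, eBoundedHolderNorm r (f i) ≠ ∞) : MemBoundedHolder r (fun x => ∑' i, f i x) :=
  lt_of_le_of_lt (eBoundedHolderNorm_tsum_le' h) (lt_top_iff_ne_top.2 h)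

/-- The `C^{0,r}` norm is invariant under negation (it is a norm: Gilbarg–Trudinger §4.1). [cite: GilbargTrudinger2001, §4.1] -/
theorem eBoundedHolderNorm_neg (r : ℝ≥0) (f : X → Y) : eBoundedHolderNorm r (-f) = eBoundedHolderNorm r f := by
  have key : ∀ g : X → Y, eHolderNorm r (-g) ≤ eHolderNorm r g := by
    intro g
    by_cases hg : MemHolder r g
    · have hw : HolderWith (nnHolderNorm r g) r (-g) := fun x y => by
        rw [Pi.neg_apply, Pi.neg_apply, edist_neg_neg]
        exact hg.holderWith x y
      exact hw.eHolderNorm_le.trans (le_of_eq hg.coe_nnHolderNorm_eq_eHolderNorm)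
    · rw [← eHolderNorm_ne_top, not_ne_iff] at hg
      rw [hg]; exact le_top
  rw [eBoundedHolderNorm_def, eBoundedHolderNorm_def, eSupNorm_neg]
  refine le_antisymm (add_le_add le_rfl (key f)) (add_le_add le_rfl ?_)
  simpa using key (-f)

/-- Triangle inequality for differences in `C^{0,r}` (Gilbarg–Trudinger §4.1: `‖·‖_{C^{0,α}}` is a norm). [cite: GilbargTrudinger2001, §4.1] -/
theorem eBoundedHolderNorm_sub_le (r : ℝ≥0) (f g : X → Y) :
    eBoundedHolderNorm r (f - g) ≤ eBoundedHolderNorm r f + eBoundedHolderNorm r g := by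
  rw [sub_eq_add_neg]
  exact (eBoundedHolderNorm_add_le f (-g)).trans (by rw [eBoundedHolderNorm_neg])

/-- The `C^{0,r}` norm of a finite sum is at most the sum of the norms (Gilbarg–Trudinger §4.1: `‖·‖_{C^{0,α}}` is a norm). [cite: GilbargTrudinger2001, §4.1] -/
theorem eBoundedHolderNorm_finset_sum_le (r : ℝ≥0) (s : Finset ι) (f : ι → X → Y) :
    eBoundedHolderNorm r (fun x => ∑ i ∈ s, f i x) ≤ ∑ i ∈ s, eBoundedHolderNorm r (f i) := by
  classical
  induction s using Finset.induction_on with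
  | empty =>
    simp only [Finset.sum_empty]
    rw [show (fun _ : X => (0 : Y)) = 0 from rfl, eBoundedHolderNorm_zero]
  | @insert a s ha ih =>
    simp only [Finset.sum_insert ha]
    have hsplit : (fun x => f a x + ∑ i ∈ s, f i x) = f a + fun x => ∑ i ∈ s, f i x := by
      funext x; simp
    rw [hsplit]
    exact (eBoundedHolderNorm_add_le _ _).trans (add_le_add le_rfl ih)

end SeriesMetric

/-! ## The M-test in `C⁰_t C^{0,r}_x` -/

section TimeDependent

variable [MetricSpace X] [NormedAddCommGroup Y] [CompleteSpace Y]

/-- **Weierstrass M-test in `C⁰(S; C^{0,r})`.** Let `f i : ℝ → X → Y` be levels, each continuous on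
the time set `S` with values in `C^{0,r}_b(X, Y)` (`ContinuousInHolderOn S r (f i)`), with
`‖f i t‖_{C^{0,r}} ≤ M i` for all `t ∈ S` and `∑ M i < ∞`. Then the series `t ↦ (x ↦ ∑' i, f i t x)`
is continuous on `S` with values in `C^{0,r}_b`: at each `t ∈ S` its norm is `≤ ∑ M i`
(`eBoundedHolderNorm_tsum_le`), and `‖F(t) − F(t₀)‖_{C^{0,r}} ≤ ∑_{i ∈ s} ‖f i t − f i t₀‖_{C^{0,r}} + 2∑_{i ∉ s} M i`
for every finite `s`, the tail being small uniformly in `t` and the finite part continuous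
(Gilbarg–Trudinger §4.1; the form in which Armstrong–Vicol's carrier `b = ∑_m b_m`, with
`‖b_m‖_{C^α} ≲ a_m N_m^{α-1}` summable, is seen to be `C⁰_t C^{0,α}_x`).
[cite: GilbargTrudinger2001, §4.1] [cite: ArmstrongVicol2025, §2.2 (PDF p. 18: b = lim b_m)] -/
theorem ContinuousInHolderOn.tsum {S : Set ℝ} {r : ℝ≥0} {f : ι → ℝ → X → Y}
    (hf : ∀ i, ContinuousInHolderOn S r (f i)) {M : ι → ℝ≥0∞}
    (hM : ∀ i, ∀ t ∈ S, eBoundedHolderNorm r (f i t) ≤ M i) (hMs : ∑' i, M i ≠ ∞) :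
    ContinuousInHolderOn S r (fun t x => ∑' i, f i t x) := by
  classical
  -- normal convergence at every `t ∈ S`
  have hsumM : ∀ t ∈ S, ∑' i, eBoundedHolderNorm r (f i t) ≤ ∑' i, M i := fun t ht =>
    ENNReal.tsum_le_tsum fun i => hM i t ht
  have hfinT : ∀ t ∈ S, ∑' i, eBoundedHolderNorm r (f i t) ≠ ∞ := fun t ht =>
    ne_top_of_le_ne_top hMs (hsumM t ht)
  have hsupT : ∀ t ∈ S, ∑' i, eSupNorm (f i t) ≠ ∞ := fun t ht =>
    ne_top_of_le_ne_top (hfinT t ht) (ENNReal.tsum_le_tsum fun i => eSupNorm_le_eBoundedHolderNorm r (f i t))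
  have hsT : ∀ t ∈ S, ∀ x, Summable fun i => f i t x := fun t ht x =>
    summable_apply_of_tsum_eSupNorm_ne_top (hsupT t ht) x
  refine ⟨fun t ht => memBoundedHolder_tsum (hfinT t ht), fun t₀ ht₀ => ?_⟩
  -- continuity at `t₀ ∈ S` in the `C^{0,r}` norm: `ε/3` argument
  refine ENNReal.tendsto_nhds_zero.2 fun ε hε => ?_
  -- a finite set of levels carrying all but `ε/3` of the budget
  have hε3 : 0 < ε / 3 := ENNReal.div_pos hε.ne' (by norm_num)
  have htail := ENNReal.tendsto_tsum_compl_atTop_zero hMs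
  obtain ⟨s, hs⟩ := (htail.eventually (gt_mem_nhds hε3)).exists
  -- the finitely many levels in `s` are continuous at `t₀`
  have hfinite : Tendsto (fun t => ∑ i ∈ s, eBoundedHolderNorm r (f i t - f i t₀)) (𝓝[S] t₀) (𝓝 0) := by
    have h := tendsto_finsetSum s fun i (_ : i ∈ s) => (hf i).2 t₀ ht₀
    rwa [Finset.sum_const_zero] at h
  have hev : ∀ᶠ t in 𝓝[S] t₀, ∑ i ∈ s, eBoundedHolderNorm r (f i t - f i t₀) < ε / 3 :=
    hfinite (gt_mem_nhds hε3)
  filter_upwards [hev, self_mem_nhdsWithin] with t ht htS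
  -- decomposition of the increment: finite part + tail at `t` − tail at `t₀`
  set Tl : ℝ → X → Y := fun τ x => ∑' i : {i // i ∉ s}, f i τ x with hTl
  have hdecomp : ∀ τ ∈ S, (fun x => ∑' i, f i τ x) = (fun x => ∑ i ∈ s, f i τ x) + Tl τ := by
    intro τ hτ
    funext x
    simp only [Pi.add_apply, hTl]
    exact ((hsT τ hτ x).sum_add_tsum_subtype_compl s).symm
  have hdiff : (fun x => ∑' i, f i t x) - (fun x => ∑' i, f i t₀ x) =
      (fun x => ∑ i ∈ s, (f i t - f i t₀) x) + (Tl t - Tl t₀) := by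
    rw [hdecomp t htS, hdecomp t₀ ht₀]
    funext x
    simp only [Pi.add_apply, Pi.sub_apply, Finset.sum_sub_distrib]
    abel
  -- tails are small, uniformly in time
  have htailτ : ∀ τ ∈ S, eBoundedHolderNorm r (Tl τ) ≤ ε / 3 := by
    intro τ hτ
    have hsub : ∀ x, Summable fun i : {i // i ∉ s} => f i τ x := fun x =>
      (hsT τ hτ x).subtype _
    refine (eBoundedHolderNorm_tsum_le hsub).trans ?_
    exact (ENNReal.tsum_le_tsum (f := fun i : {i // i ∉ s} => eBoundedHolderNorm r (f i τ))
      (g := fun i : {i // i ∉ s} => M i) fun i => hM i τ hτ).trans hs.le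
  -- assemble
  rw [hdiff]
  calc eBoundedHolderNorm r ((fun x => ∑ i ∈ s, (f i t - f i t₀) x) + (Tl t - Tl t₀))
      ≤ eBoundedHolderNorm r (fun x => ∑ i ∈ s, (f i t - f i t₀) x) + eBoundedHolderNorm r (Tl t - Tl t₀) :=
        eBoundedHolderNorm_add_le _ _
    _ ≤ (∑ i ∈ s, eBoundedHolderNorm r (f i t - f i t₀)) + (eBoundedHolderNorm r (Tl t) + eBoundedHolderNorm r (Tl t₀)) :=
        add_le_add (eBoundedHolderNorm_finset_sum_le r s _) (eBoundedHolderNorm_sub_le r _ _)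
    _ ≤ ε / 3 + (ε / 3 + ε / 3) := add_le_add ht.le (add_le_add (htailτ t htS) (htailτ t₀ ht₀))
    _ = ε := by rw [← add_assoc, ENNReal.add_thirds]

/-- The norm bound that comes with the M-test: `‖∑ fᵢ(t)‖_{C^{0,r}} ≤ ∑ Mᵢ` at every `t ∈ S`.
[cite: GilbargTrudinger2001, §4.1] -/
theorem eBoundedHolderNorm_tsum_le_of_forall_le {S : Set ℝ} {r : ℝ≥0} {f : ι → ℝ → X → Y}
    {M : ι → ℝ≥0∞} (hM : ∀ i, ∀ t ∈ S, eBoundedHolderNorm r (f i t) ≤ M i) (hMs : ∑' i, M i ≠ ∞)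
    {t : ℝ} (ht : t ∈ S) :
    eBoundedHolderNorm r (fun x => ∑' i, f i t x) ≤ ∑' i, M i := by
  have hle : ∑' i, eBoundedHolderNorm r (f i t) ≤ ∑' i, M i := ENNReal.tsum_le_tsum fun i => hM i t ht
  exact (eBoundedHolderNorm_tsum_le' (ne_top_of_le_ne_top hMs hle)).trans hle

end TimeDependent

/-! ## Time sets: restriction, unions, window covers -/

section TimeSets

variable [PseudoEMetricSpace X] [NormedAddCommGroup Y] {r : ℝ≥0} {v : ℝ → X → Y}

/-- Restriction of the time set. [cite: LellisSzekelyhidi2013, §2 (Hölder spaces, C(I; C^α))] -/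
theorem ContinuousInHolderOn.mono {S S' : Set ℝ} (h : ContinuousInHolderOn S r v) (hS : S' ⊆ S) :
    ContinuousInHolderOn S' r v :=
  ⟨fun t ht => h.1 t (hS ht), fun t₀ ht₀ => (h.2 t₀ (hS ht₀)).mono_left (nhdsWithin_mono _ hS)⟩

/-- **Union of two CLOSED time sets.** `C⁰(S₁; C^{0,r})` and `C⁰(S₂; C^{0,r})` with `S₁, S₂` closed give
`C⁰(S₁ ∪ S₂; C^{0,r})` (at a point of `S₁` outside the closed `S₂` the filter `𝓝[S₂]` is trivial).
[cite: LellisSzekelyhidi2013, §2 (Hölder spaces, C(I; C^α))] -/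
theorem ContinuousInHolderOn.union {S₁ S₂ : Set ℝ} (h₁ : ContinuousInHolderOn S₁ r v)
    (h₂ : ContinuousInHolderOn S₂ r v) (hc₁ : IsClosed S₁) (hc₂ : IsClosed S₂) :
    ContinuousInHolderOn (S₁ ∪ S₂) r v := by
  refine ⟨fun t ht => ht.elim (h₁.1 t) (h₂.1 t), fun t₀ ht₀ => ?_⟩
  rw [nhdsWithin_union]
  refine Tendsto.sup ?_ ?_
  · by_cases h : t₀ ∈ S₁
    · exact h₁.2 t₀ h
    · have hbot : 𝓝[S₁] t₀ = ⊥ := notMem_closure_iff_nhdsWithin_eq_bot.1 (by rwa [hc₁.closure_eq])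
      rw [hbot]; exact tendsto_bot
  · by_cases h : t₀ ∈ S₂
    · exact h₂.2 t₀ h
    · have hbot : 𝓝[S₂] t₀ = ⊥ := notMem_closure_iff_nhdsWithin_eq_bot.1 (by rwa [hc₂.closure_eq])
      rw [hbot]; exact tendsto_bot

/-- **Gluing adjacent time intervals**: `C⁰([a,b]; C^{0,r})` and `C⁰([b,c]; C^{0,r})` give
`C⁰([a,c]; C^{0,r})` (no order hypotheses: `[a,c] ⊆ [a,b] ∪ [b,c]` always).
[cite: LellisSzekelyhidi2013, §2 (Hölder spaces, C(I; C^α))] -/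
theorem ContinuousInHolderOn.Icc_union_Icc {a b c : ℝ} (h₁ : ContinuousInHolderOn (Icc a b) r v)
    (h₂ : ContinuousInHolderOn (Icc b c) r v) : ContinuousInHolderOn (Icc a c) r v := by
  refine (h₁.union h₂ isClosed_Icc isClosed_Icc).mono fun t ht => ?_
  rcases le_or_gt t b with htb | htb
  · exact Or.inl ⟨ht.1, htb⟩
  · exact Or.inr ⟨htb.le, ht.2⟩

/-- **Locally finite window covers.** If `v ∈ C⁰([jτ, (j+1)τ]; C^{0,r})` on every window, `j ∈ ℤ`,
`τ > 0`, then `v ∈ C⁰(ℝ; C^{0,r})` (three consecutive windows form a neighbourhood of each time).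
[cite: LellisSzekelyhidi2013, §2 (Hölder spaces, C(I; C^α))] -/
theorem continuousInHolderOn_univ_of_windows {τ : ℝ} (hτ : 0 < τ)
    (h : ∀ j : ℤ, ContinuousInHolderOn (Icc (j * τ) ((j + 1) * τ)) r v) :
    ContinuousInHolderOn univ r v := by
  -- the window of a time and the triple window around it
  have hwin : ∀ t : ℝ, t ∈ Icc ((⌊t / τ⌋ : ℤ) * τ) (((⌊t / τ⌋ : ℤ) + 1) * τ) := fun t =>
    ⟨(le_div_iff₀ hτ).1 (Int.floor_le _), ((div_lt_iff₀ hτ).1 (Int.lt_floor_add_one _)).le⟩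
  have htriple : ∀ j : ℤ, ContinuousInHolderOn (Icc (((j : ℝ) - 1) * τ) (((j : ℝ) + 2) * τ)) r v := by
    intro j
    have hm := h (j - 1)
    have hp := h (j + 1)
    push_cast at hm hp
    rw [sub_add_cancel] at hm
    have h12 : ContinuousInHolderOn (Icc (((j : ℝ) - 1) * τ) (((j : ℝ) + 1) * τ)) r v := hm.Icc_union_Icc (h j)
    have h3 := h12.Icc_union_Icc (show ContinuousInHolderOn (Icc (((j : ℝ) + 1) * τ) (((j : ℝ) + 2) * τ)) r v by
      convert hp using 3; ring)
    exact h3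
  refine ⟨fun t _ => (h ⌊t / τ⌋).1 t (hwin t), fun t₀ _ => ?_⟩
  set j : ℤ := ⌊t₀ / τ⌋ with hj
  have hmem : Icc (((j : ℝ) - 1) * τ) (((j : ℝ) + 2) * τ) ∈ 𝓝 t₀ := by
    refine mem_of_superset (Ioo_mem_nhds ?_ ?_) Ioo_subset_Icc_self
    · have h1 := (hwin t₀).1; rw [← hj] at h1; nlinarith
    · have h2 := (hwin t₀).2; rw [← hj] at h2; nlinarith
  have ht₀ : t₀ ∈ Icc (((j : ℝ) - 1) * τ) (((j : ℝ) + 2) * τ) := mem_of_mem_nhds hmem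
  have hc := (htriple j).2 t₀ ht₀
  rwa [nhdsWithin_eq_nhds.2 hmem, ← nhdsWithin_univ] at hc

end TimeSets

/-! ## The constructor: joint continuity and a uniform spatial Lipschitz bound -/

section Constructor

variable [MetricSpace X] [CompactSpace X] [NormedAddCommGroup Y]

/-- **`C⁰_t C^{0,r}_x` from joint continuity and a `t`-uniform Lipschitz bound in `x`, `r < 1`.**
If `v : ℝ → X → Y` is jointly continuous on `ℝ × X` (`X` a compact metric space) and every slice
`v t` is `K`-Lipschitz with `K` independent of `t`, then `v ∈ C⁰(ℝ; C^{0,r}_b)` for every `r < 1`: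
by the tube lemma `v t → v t₀` uniformly as `t → t₀`, and by interpolation
`‖v t − v t₀‖_{C^{0,r}} ≤ osc + 2 (2K)^r (2 osc)^{1-r} → 0` (`osc = ‖v t − v t₀‖_∞`). The form in
which the levels of a multiscale carrier — jointly continuous, smooth in `x` with `t`-uniform
derivative bounds, but only window-wise smooth in `t` — enter the M-test `ContinuousInHolderOn.tsum`.
[cite: LellisSzekelyhidi2013, §2 (Hölder spaces, C(I; C^α))] [cite: GilbargTrudinger2001, (6.8)–(6.9)] -/
theorem continuousInHolderOn_univ_of_continuous_of_lipschitzWith {v : ℝ → X → Y}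
    (hc : Continuous (uncurry v)) {K : ℝ≥0} (hK : ∀ t, LipschitzWith K (v t)) {r : ℝ≥0} (hr : r < 1) :
    ContinuousInHolderOn univ r v := by
  -- every slice is bounded (compactness) and Lipschitz, hence in `C^{0,r}_b`
  have hbd : ∀ t, ∃ M : ℝ≥0, ∀ x, ‖v t x‖ ≤ M := by
    intro t
    obtain ⟨C, hC⟩ := isCompact_univ.exists_bound_of_continuousOn
      ((hc.uncurry_left t).continuousOn (s := univ))
    exact ⟨C.toNNReal, fun x => (hC x (mem_univ x)).trans (Real.le_coe_toNNReal C)⟩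
  refine ⟨fun t _ => ?_, fun t₀ _ => ?_⟩
  · obtain ⟨M, hM⟩ := hbd t
    exact lt_of_le_of_lt (eBoundedHolderNorm_le_of_norm_le_of_lipschitzWith hM (hK t) hr.le) ENNReal.coe_lt_top
  -- the modulus `φ η = η + 2 (K+K)^r (2η)^{1-r}` tends to `0` with `η` (uses `r < 1`)
  set φ : ℝ≥0 → ℝ≥0 := fun η => η + 2 * (K + K) ^ (r : ℝ) * (2 * η) ^ (1 - r : ℝ) with hφ
  have h1r : (0 : ℝ) < 1 - r := by
    have : (r : ℝ) < 1 := by exact_mod_cast hr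
    linarith
  have hφc : Continuous φ :=
    continuous_id.add (continuous_const.mul
      ((NNReal.continuous_rpow_const h1r.le).comp (continuous_const.mul continuous_id)))
  have hφ0 : φ 0 = 0 := by
    simp only [hφ, mul_zero, NNReal.zero_rpow h1r.ne', zero_add]
  have hφt : Tendsto φ (𝓝 0) (𝓝 0) := by
    have h := hφc.tendsto 0
    rwa [hφ0] at h
  -- uniform convergence of the slices (tube lemma)
  have hU : TendstoUniformly v (v t₀) (𝓝 t₀) := hc.tendstoUniformly v t₀
  rw [nhdsWithin_univ]
  refine ENNReal.tendsto_nhds_zero.2 fun ε hε => ?_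
  rcases eq_or_ne ε ⊤ with rfl | hεtop
  · exact Eventually.of_forall fun _ => le_top
  have hε' : (0 : ℝ≥0) < ε.toNNReal := by
    rw [pos_iff_ne_zero]
    intro h0
    rcases (ENNReal.toNNReal_eq_zero_iff ε).1 h0 with h | h
    · exact hε.ne' h
    · exact hεtop h
  obtain ⟨δ, hδ0, hδ⟩ := NNReal.nhds_zero_basis.eventually_iff.1 (hφt.eventually (gt_mem_nhds hε'))
  have hη0 : (0 : ℝ) < (δ / 2 : ℝ≥0) := by
    have : (0 : ℝ≥0) < δ / 2 := by positivity
    exact_mod_cast this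
  filter_upwards [Metric.tendstoUniformly_iff.1 hU (δ / 2 : ℝ≥0) hη0] with t ht
  -- at such `t`: oscillation `≤ δ/2`, Lipschitz constant `K + K`
  have hosc : ∀ x, ‖(v t - v t₀) x‖ ≤ (δ / 2 : ℝ≥0) := fun x => by
    rw [Pi.sub_apply, ← dist_eq_norm, dist_comm]
    exact (ht x).le
  have hlip : LipschitzWith (K + K) (v t - v t₀) := (hK t).sub (hK t₀)
  refine (eBoundedHolderNorm_le_of_norm_le_of_lipschitzWith hosc hlip hr.le).trans ?_
  have hlt : φ (δ / 2) < ε.toNNReal := hδ (NNReal.half_lt_self hδ0.ne')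
  calc ((δ / 2 + 2 * (K + K) ^ (r : ℝ) * (2 * (δ / 2)) ^ (1 - r : ℝ) : ℝ≥0) : ℝ≥0∞)
      = (φ (δ / 2) : ℝ≥0∞) := rfl
    _ ≤ (ε.toNNReal : ℝ≥0∞) := ENNReal.coe_le_coe.2 hlt.le
    _ = ε := ENNReal.coe_toNNReal hεtop

end Constructor

section TorusConstructor

variable {d : Type*} [Fintype d] [DecidableEq d] [NormedAddCommGroup Y] [NormedSpace ℝ Y]

/-- **Torus form of the constructor**: a jointly continuous `v : ℝ → T^d → Y` whose slices are `C¹`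
with `‖∂ᵢ (v t)‖_∞ ≤ L` uniformly in `t` is `C⁰(ℝ; C^{0,r}_b)` for every `r < 1` (the slices are
`√d·(d L)`-Lipschitz, `Torus.lipschitzWith_of_norm_partialDeriv_le`).
[cite: LellisSzekelyhidi2013, §2 (Hölder spaces, C(I; C^α))] [cite: GilbargTrudinger2001, §4.1] -/
theorem Torus.continuousInHolderOn_univ_of_continuous_of_norm_partialDeriv_le
    {v : ℝ → UnitAddTorus d → Y} (hc : Continuous (uncurry v)) (hv : ∀ t, Torus.IsContDiff 1 (v t))
    {L : ℝ≥0} (h1 : ∀ t i x, ‖Torus.partialDeriv i (v t) x‖ ≤ L) {r : ℝ≥0} (hr : r < 1) :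
    ContinuousInHolderOn univ r v :=
  continuousInHolderOn_univ_of_continuous_of_lipschitzWith hc
    (fun t => Torus.lipschitzWith_of_norm_partialDeriv_le (hv t) (M := fun _ => L) (h1 t)) hr

end TorusConstructor

end Literature.Analysis.FunctionSpaces

end
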